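import Summits.AtomisticToContinuum.Crystallization.Theorems.FrustratedLawDichotomyStrainedPatchHomEntryTableK
import Summits.AtomisticToContinuum.Crystallization.Theorems.FrustratedLawDichotomyStrainedPatchHomEntryTableHcp

/-!
# (H) TARGET CERTIFICATE v6: tiered tables on BOTH sides (critic row 881)

decomp-a2c hand-1 g22 (crux `AperiodicFrustratedLawGap`, stmt-AtomisticToContinuum-27623).  DEF-FREE composition of hand-1's fcc tiered verdict
(`…HomEntryTableK.fccHalf_of_entrySearch6RBK`: fundamental domain ×24, radial, every fit, v2 table ∨ tiers K1–K4) with hand-2's hcp tiered verdict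
(`…HomEntryTableHcp.hcpHalf_of_entrySearchH3RDTK`: shuffle-sign domain, radial, sharp fit, hcp leaf table over the same tiers) through
`…HomPrunedPolar.homFloor_of_prunedBoxSums_selfAdjoint`: ★★★ `homFloor_of_entrySearches6RBK3RDTK` (every `m`, `μ` with `2 (m + e_W) SC ≤ μ`),
`homFloor_625_of_entrySearches6RBK3RDTK` (`μ = muRec`), `homFloor_milli_of_entrySearches6RBK3RDTK` (`μ = muMilli`).  0 sorry; standard axioms.
`--supports stmt-AtomisticToContinuum-27623`.
-/

namespace Summit.AtomisticToContinuum.Crystallization.Theorems.FrustratedLawDichotomyStrainedPatchHomEntryTableKH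

open Literature.Analysis.ValidatedNumerics.Numerics
open Summit.AtomisticToContinuum.Crystallization.Theorems.FrustratedLawDichotomyStrainedPatchHomSplit (HomFloor)
open Summit.AtomisticToContinuum.Crystallization.Theorems.FrustratedLawDichotomyStrainedPatchHomPrunedPolar (homFloor_of_prunedBoxSums_selfAdjoint)
open Summit.AtomisticToContinuum.Crystallization.Theorems.FrustratedLawDichotomyStrainedPatchHomEntryGram (rootC rootW)
open Summit.AtomisticToContinuum.Crystallization.Theorems.FrustratedLawDichotomyStrainedPatchHomEntryGramHcp (rootCH rootWH)
open Summit.AtomisticToContinuum.Crystallization.Theorems.FrustratedLawDichotomyStrainedPatchHomEntryTable (muRec muRec_ok)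
open Summit.AtomisticToContinuum.Crystallization.Theorems.FrustratedLawDichotomyStrainedPatchHomEntrySix (muMilli muMilli_ok)
open Summit.AtomisticToContinuum.Crystallization.Theorems.FrustratedLawDichotomyStrainedPatchHomEntrySearch (searchOK)
open Summit.AtomisticToContinuum.Crystallization.Theorems.FrustratedLawDichotomyStrainedPatchHomEntryTableK (entryLeafOK6RBK fccHalf_of_entrySearch6RBK)
open Summit.AtomisticToContinuum.Crystallization.Theorems.FrustratedLawDichotomyStrainedPatchHomEntryTableHcp (entryLeafOKH3RDTK hcpHalf_of_entrySearchH3RDTK)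

/-- ★★★ **`(H) HomFloor m` FROM TWO SEARCH BOOLEANS, tiered tables on both sides** (fcc `entryLeafOK6RBK μ`, hcp `entryLeafOKH3RDTK μ`; every `m`, `μ`
with `2 (m + e_W) SC ≤ μ`; any selectors, fuel, depth). [folklore] -/
theorem homFloor_of_entrySearches6RBK3RDTK {m : ℝ} {μ : ℤ} (hμ : 2 * (m + (-(7175 / 10000) + 3 / 400)) * SC ≤ μ)
    {selF : ℕ → (Fin 3 × Fin 3 → ℤ) → (Fin 3 × Fin 3 → ℤ) → Fin 3 × Fin 3} {fuelF dF : ℕ}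
    (hF : searchOK (entryLeafOK6RBK μ) selF fuelF dF rootC rootW = true)
    {selH : ℕ → ((Fin 3 × Fin 3) ⊕ Fin 3 → ℤ) → ((Fin 3 × Fin 3) ⊕ Fin 3 → ℤ) → (Fin 3 × Fin 3) ⊕ Fin 3} {fuelH dH : ℕ}
    (hH : searchOK (entryLeafOKH3RDTK μ) selH fuelH dH rootCH rootWH = true) : HomFloor m :=
  homFloor_of_prunedBoxSums_selfAdjoint (fccHalf_of_entrySearch6RBK hμ hF) (hcpHalf_of_entrySearchH3RDTK hμ hH)

/-- ★★★ **`(H) HomFloor (1/625)`, TARGET CERTIFICATE v6** (critic row 881): `searchOK (entryLeafOK6RBK muRec) … rootC rootW = true` and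
`searchOK (entryLeafOKH3RDTK muRec) … rootCH rootWH = true` give `HomFloor (1/625)`. [folklore] -/
theorem homFloor_625_of_entrySearches6RBK3RDTK
    {selF : ℕ → (Fin 3 × Fin 3 → ℤ) → (Fin 3 × Fin 3 → ℤ) → Fin 3 × Fin 3} {fuelF dF : ℕ}
    (hF : searchOK (entryLeafOK6RBK muRec) selF fuelF dF rootC rootW = true)
    {selH : ℕ → ((Fin 3 × Fin 3) ⊕ Fin 3 → ℤ) → ((Fin 3 × Fin 3) ⊕ Fin 3 → ℤ) → (Fin 3 × Fin 3) ⊕ Fin 3} {fuelH dH : ℕ}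
    (hH : searchOK (entryLeafOKH3RDTK muRec) selH fuelH dH rootCH rootWH = true) : HomFloor (1 / 625) :=
  homFloor_of_entrySearches6RBK3RDTK muRec_ok hF hH

/-- ★★★ **`(H) HomFloor (1/1000)`** — v6 at `μ = muMilli`. [folklore] -/
theorem homFloor_milli_of_entrySearches6RBK3RDTK
    {selF : ℕ → (Fin 3 × Fin 3 → ℤ) → (Fin 3 × Fin 3 → ℤ) → Fin 3 × Fin 3} {fuelF dF : ℕ}
    (hF : searchOK (entryLeafOK6RBK muMilli) selF fuelF dF rootC rootW = true)
    {selH : ℕ → ((Fin 3 × Fin 3) ⊕ Fin 3 → ℤ) → ((Fin 3 × Fin 3) ⊕ Fin 3 → ℤ) → (Fin 3 × Fin 3) ⊕ Fin 3} {fuelH dH : ℕ}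
    (hH : searchOK (entryLeafOKH3RDTK muMilli) selH fuelH dH rootCH rootWH = true) : HomFloor (1 / 1000) :=
  homFloor_of_entrySearches6RBK3RDTK muMilli_ok hF hH

end Summit.AtomisticToContinuum.Crystallization.Theorems.FrustratedLawDichotomyStrainedPatchHomEntryTableKH
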